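import Summits.HodgeConjecture.HodgeConjecture.Theorems.Ring2AbelianAllWeilCellsAnchored
import HarnessLib

/-!
# Ring 2 · Weil-type family-coverage census (ring2-b02, gen 50) — ONE CM abelian variety is a polarized member of
  EVERY component `(n, K = ℚ(√-d), δ)` of the right sign: CM points distinguish no component

research route conditional on HC_CM; not a corollary; Q11.4-sentence-2 already refuted in dim ≥ 3.
`HC_CM` (`Theses.RankFourFaces.CMAbelianHodge`) does not occur in this file; nothing here is a case of the Hodge
conjecture beyond Tate's theorem for products of ONE CM elliptic curve (van Geemen Thm. 4.3, in the tree), which is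
quoted, not re-proved.

WHAT THIS FILE ADDS (kernel form of the header sentence of `HOME/WEIL-FAMILY-COVERAGE.md` «## b02 (g = 6)» /
«## b01» b01.5: «CM points distinguish no class a»). ab-weil-1's CM tower (`Ring2.AbelianAll.exists_member`,
`exists_cmMember`, `weilComponent_cmAnchor`) inhabits every right-sign cell `(n, d, δ)` by a CM member, the member
being produced PER `δ` (an existential over `(A, φ, e)` for each class). Here the quantifiers are exchanged:
for every `n ≥ 1`, `d ≥ 1` there is ONE pair `(A, φ)` — the CM tower `(E₀ × E₀)ⁿ` over ONE curve `E₀ = ℂ/ℤ[√-d]`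
with `φ = (ψ₀ × (-ψ₀))ⁿ` — which is of Weil type `(n, d)`, of CM type, SATISFIES the Hodge conjecture (Tate), and
carries, for EVERY class `δ` with `sign δ = (-1)ⁿ`, a `K`-symmetrised hyperplane class `d·e^*a + φ^*e^*a` of
non-degenerate discriminant class EXACTLY `δ` (`exists_commonCMMember`); equivalently the set of classes `δ` realised
on this one abelian variety is the set of ALL inhabited components (`commonCMMember_realises_iff_sign`, with gen 7's
sign theorem for the converse). So a CM point decides no component: the open content of a non-split component is its
general member (van Geemen 5.3: every `(X, K, E)` is a member of an `n²`-dimensional family), exactly as the census says.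

PROOF. Only the ORDER of the existentials is new; every ingredient is ab-weil-1's (parts 1, 2, 4) and the Literature
layer: the CM square `(E₀ × E₀, ψ₀ × (-ψ₀))` over a FIXED curve is of Weil type `(1, d)` (`exists_weilType_cmSquare`)
and its weighted Segre embeddings realise every negative class `[-m₁m₂]` (`exists_projectiveEmbedding_cmSquare`,
`hasWeilDiscriminantNondeg_cmSquare`) — §1 repackages part 2's `exists_member_one` with `(A, φ)` OUTSIDE the
existential; §2 runs part 4's induction with the tower fixed before `δ` (products: `isWeilType_prod`,
`exists_projectiveEmbedding_prod`, `hasWeilDiscriminantNondeg_prod`; `δ = (δ·[-1])·[-1]`); §3 adds Tate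
(`EllipticCurve.hodgeConjectureFor_of_hodgeOneZero_mem_span_pullback`) and the sign converse.

## References
* B. van Geemen, *An introduction to the Hodge conjecture for abelian varieties*, LNM 1594 (1994), Thm. 4.3, 4.11,
  4.14, Lemma 5.2 (2)–(4), 5.3–5.5. [vanGeemen1994HodgeAV]
* J. S. Milne, *Lefschetz motives and the Tate conjecture*, Compositio Math. 117 (1999), §2 p. 54. [Milne1999]
* R. Hartshorne, *Algebraic Geometry* (1977), II Ex. 5.11–5.12 (Segre). [Hartshorne1977]
-/

noncomputable section

set_option linter.dupNamespace false

open CategoryTheory MonoidalCategory AlgebraicGeometry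
open Literature.AlgebraicGeometry Literature.AlgebraicGeometry.Motives
open Literature.AlgebraicGeometry.Motives.SegreHyperplaneClass
open Literature.AlgebraicGeometry.HodgeTheory
open Literature.AlgebraicGeometry.Milne1999 (IsOfCMType)
open Literature.AlgebraicGeometry.VanGeemen1994
open Literature.AlgebraicTopology.SingularHomology
open Literature.Geometry.Kaehler
open Summit.HodgeConjecture.HodgeConjecture.Ring2.Hypotheses
open Summit.HodgeConjecture.HodgeConjecture.Ring2.AbelianAll

namespace Summit.HodgeConjecture.HodgeConjecture.Ring2.WeilCoverage

/-! ### §1 The CM square over ONE curve, with `(A, φ)` outside the existential -/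

/-- **The CM square `(E₀ × E₀, ψ₀ × (-ψ₀))` over a FIXED curve is of Weil type `(1, d)` and realises EVERY class
`[-m₁m₂]`** (`m₁, m₂ ≥ 1`) as the non-degenerate discriminant class of a `K`-symmetrised hyperplane class of one of
its weighted Segre embeddings, with `h_K² ≠ 0` — ab-weil-1's `exists_member_one` with the pair `(A, φ)` fixed
before the weights. [cite: vanGeemen1994HodgeAV, 5.3 and Lemma 5.2 (2)–(4)] [cite: Hartshorne1977, II Ex. 5.11 and Ex. 5.12] -/
theorem cmSquare_isWeilType_and_forall_weights (g : (N : ℕ) → complexBetti (projectiveSpace N ℂ) 2)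
    (hgr : ∀ N : ℕ, IsRationalClass (g N)) (hgnz : ∀ N : ℕ, 1 ≤ N → g N ≠ 0)
    (hgσ : ∀ n m : ℕ, complexBetti.map (segreEmbedding n m ℂ) 2 (g (n * m + n + m)) =
      complexBetti.map (CartesianMonoidalCategory.fst (projectiveSpace n ℂ) (projectiveSpace m ℂ)) 2 (g n) +
        complexBetti.map (CartesianMonoidalCategory.snd (projectiveSpace n ℂ) (projectiveSpace m ℂ)) 2 (g m))
    {E₀ : AbelianVariety ℂ} {ψ₀ : E₀ ⟶ E₀} {d : ℕ} (hE : E₀.dim = 1) (hd : 0 < d) (hψ : ψ₀ ≫ ψ₀ = -(d • 𝟙 E₀)) :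
    IsWeilType (E₀.prod E₀)
        (AbelianVariety.prodLift (AbelianVariety.fst E₀ E₀ ≫ ψ₀) (AbelianVariety.snd E₀ E₀ ≫ (-ψ₀))) 1 d ∧
      ∀ {m₁ m₂ : ℕ}, 0 < m₁ → 0 < m₂ → ∀ h0 : ((m₁ : ℚ) * m₂) ≠ 0,
        ∃ e : ProjectiveEmbedding (E₀.prod E₀).X, 1 ≤ e.n ∧
          HasWeilDiscriminantNondeg (E₀.prod E₀)
              (AbelianVariety.prodLift (AbelianVariety.fst E₀ E₀ ≫ ψ₀) (AbelianVariety.snd E₀ E₀ ≫ (-ψ₀))) 1 d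
              ((d : ℂ) • complexBetti.map e.ι 2 (g e.n) +
                complexBetti.map (AbelianVariety.prodLift (AbelianVariety.fst E₀ E₀ ≫ ψ₀)
                  (AbelianVariety.snd E₀ E₀ ≫ (-ψ₀))).hom.hom.hom 2 (complexBetti.map e.ι 2 (g e.n)))
              (QuotientGroup.mk (-(Units.mk0 ((m₁ : ℚ) * m₂) h0))) ∧
          lefschetzPow ((d : ℂ) • complexBetti.map e.ι 2 (g e.n) +
                complexBetti.map (AbelianVariety.prodLift (AbelianVariety.fst E₀ E₀ ≫ ψ₀)
                  (AbelianVariety.snd E₀ E₀ ≫ (-ψ₀))).hom.hom.hom 2 (complexBetti.map e.ι 2 (g e.n)))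
              (2 * 1 - 1) 2
            ((d : ℂ) • complexBetti.map e.ι 2 (g e.n) +
                complexBetti.map (AbelianVariety.prodLift (AbelianVariety.fst E₀ E₀ ≫ ψ₀)
                  (AbelianVariety.snd E₀ E₀ ≫ (-ψ₀))).hom.hom.hom 2 (complexBetti.map e.ι 2 (g e.n))) ≠ 0 := by
  obtain ⟨hBdim, -, hΨ, up, um, hup, hum, -, hH, hup0, -⟩ := exists_weilType_cmSquare hE hd hψ
  -- Weil type `(1, d)` of the square, from its non-zero `(1,1)` Weil class `u₊ + u₋` (as in part 2)
  have hdis := disjoint_weilClassesPlus_weilClassesMinus (A := E₀.prod E₀)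
    (φ := AbelianVariety.prodLift (AbelianVariety.fst E₀ E₀ ≫ ψ₀) (AbelianVariety.snd E₀ E₀ ≫ (-ψ₀))) one_pos hd
  have hc0 : up + um ≠ 0 := by
    intro h
    have hup' : up ∈ weilClassesMinus (E₀.prod E₀)
        (AbelianVariety.prodLift (AbelianVariety.fst E₀ E₀ ≫ ψ₀) (AbelianVariety.snd E₀ E₀ ≫ (-ψ₀))) 1 d := by
      rw [eq_neg_of_add_eq_zero_left h]; exact Submodule.neg_mem _ hum
    exact hup0 (Submodule.disjoint_def.1 hdis up hup hup')
  have hW : IsWeilType (E₀.prod E₀)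
      (AbelianVariety.prodLift (AbelianVariety.fst E₀ E₀ ≫ ψ₀) (AbelianVariety.snd E₀ E₀ ≫ (-ψ₀))) 1 d :=
    isWeilType_of_weilClass_ne_zero one_pos hd hBdim hΨ
      (Submodule.add_mem _ (weilClassesPlus_le_weilClassesOf _ _ 1 d hup) (weilClassesMinus_le_weilClassesOf _ _ 1 d hum))
      hc0 hH
  refine ⟨hW, ?_⟩
  intro m₁ m₂ hm₁ hm₂ h0
  obtain ⟨M, f₀, e, hM, hen, hecl⟩ := exists_projectiveEmbedding_cmSquare g hgσ E₀ hm₁ hm₂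
  -- `η = f₀^* g_M` is rational and non-zero (else `h_K = 0`, contradicting non-degeneracy, Lemma 5.2 (1))
  have hηr : IsRationalClass (complexBetti.map f₀ 2 (g M)) := (hgr M).pullback (AlgPoints.mapContinuous (L := ℂ) f₀)
  have hη0 : complexBetti.map f₀ 2 (g M) ≠ 0 := by
    intro h0'
    obtain ⟨δ, hδ⟩ := exists_hasWeilDiscriminantNondeg one_pos hBdim hd hΨ e (hgr _) (hgnz _ hen)
    have hcl : complexBetti.map e.ι 2 (g e.n) = 0 := by
      rw [hecl, h0', smul_zero, smul_zero, map_zero, map_zero, add_zero]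
    rw [hcl, map_zero, smul_zero, add_zero] at hδ
    exact not_hasWeilDiscriminantNondeg_zero one_pos δ hδ
  -- `(±√-d)^* = d` on `H²(E₀)`
  have h2 : ∀ x : complexBetti E₀.X 2, complexBetti.map ψ₀.hom.hom.hom 2 x = (d : ℂ) • x :=
    fun x => cmCurve_map_two hE hd hψ x
  have hψ' : (-ψ₀) ≫ (-ψ₀) = -(d • 𝟙 E₀) := by rw [Preadditive.neg_comp_neg]; exact hψ
  have h2' : ∀ x : complexBetti E₀.X 2, complexBetti.map (-ψ₀).hom.hom.hom 2 x = (d : ℂ) • x :=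
    fun x => cmCurve_map_two hE hd hψ' x
  have hs₁ : ((2 * d * m₁ : ℕ) : ℚ) ≠ 0 := by positivity
  have hs₂ : ((2 * d * m₂ : ℕ) : ℚ) ≠ 0 := by positivity
  -- `h_K = pr₁^*(2dm₁ η) + pr₂^*(2dm₂ η)`
  have hK : (d : ℂ) • complexBetti.map e.ι 2 (g e.n) +
      complexBetti.map (AbelianVariety.prodLift (AbelianVariety.fst E₀ E₀ ≫ ψ₀)
        (AbelianVariety.snd E₀ E₀ ≫ (-ψ₀))).hom.hom.hom 2 (complexBetti.map e.ι 2 (g e.n)) =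
      complexBetti.map (AbelianVariety.fst E₀ E₀).hom.hom.hom 2
          ((((2 * d * m₁ : ℕ) : ℚ) : ℂ) • complexBetti.map f₀ 2 (g M)) +
        complexBetti.map (AbelianVariety.snd E₀ E₀).hom.hom.hom 2
          ((((2 * d * m₂ : ℕ) : ℚ) : ℂ) • complexBetti.map f₀ 2 (g M)) := by
    have e₁ : (d : ℂ) * ((m₁ : ℕ) : ℂ) + (d : ℂ) * ((m₁ : ℕ) : ℂ) = (((2 * d * m₁ : ℕ) : ℚ) : ℂ) := by
      push_cast; ring
    have e₂ : (d : ℂ) * ((m₂ : ℕ) : ℂ) + (d : ℂ) * ((m₂ : ℕ) : ℂ) = (((2 * d * m₂ : ℕ) : ℚ) : ℂ) := by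
      push_cast; ring
    rw [hecl, smul_add_map_prodLift, h2, h2', smul_smul, ← add_smul, e₁, smul_smul, ← add_smul, e₂]
  obtain ⟨hN, htop⟩ := hasWeilDiscriminantNondeg_cmSquare hE hd hψ hηr hη0 hs₁ hs₂
  have hδ : (QuotientGroup.mk (-(Units.mk0 _ hs₁ * Units.mk0 _ hs₂)) : weilNormResidueGroup d) =
      QuotientGroup.mk (-(Units.mk0 ((m₁ : ℚ) * m₂) h0)) := by
    rw [← mk_pow_two_mul_pow_mul d (Units.mk0 ((2 * d : ℕ) : ℚ) (by positivity))
      (-(Units.mk0 ((m₁ : ℚ) * m₂) h0)) 1]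
    congr 1
    ext
    simp only [Units.val_neg, Units.val_mul, Units.val_pow_eq_pow_val, Units.val_mk0]
    push_cast
    ring
  refine ⟨e, hen, ?_, ?_⟩
  · rw [hK, ← hδ]; exact hN
  · rw [hK]; exact htop

/-! ### §2 The CM tower over ONE curve with `(A, φ)` fixed BEFORE the class `δ` -/

/-- **The common CM tower.** For `E₀` with `ψ₀² = -d` (`d ≥ 1`) and every `n ≥ 1` there is ONE pair `(A, φ)`
(`A = (E₀ × E₀)ⁿ`, `φ = (ψ₀ × (-ψ₀))ⁿ`), of Weil type `(n, d)`, of CM type, with `H^{1,0}(A)` pulled back from `E₀`,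
such that EVERY class `δ` with `sign δ = (-1)ⁿ` is the non-degenerate discriminant class of the `K`-symmetrised
hyperplane class of SOME projective embedding of this same `A` (with non-zero top power). Induction on `n` as in
ab-weil-1's `exists_cmMember`, the tower being fixed before `δ`: `δ = (δ·[-1])·[-1]`.
[cite: vanGeemen1994HodgeAV, 4.11, 4.14, 5.3 and Lemma 5.2 (3)] [cite: Milne1999, §2 p. 54] -/
theorem exists_commonCMMember_aux (g : (N : ℕ) → complexBetti (projectiveSpace N ℂ) 2)
    (hgr : ∀ N : ℕ, IsRationalClass (g N)) (hgnz : ∀ N : ℕ, 1 ≤ N → g N ≠ 0)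
    (hgσ : ∀ n m : ℕ, complexBetti.map (segreEmbedding n m ℂ) 2 (g (n * m + n + m)) =
      complexBetti.map (CartesianMonoidalCategory.fst (projectiveSpace n ℂ) (projectiveSpace m ℂ)) 2 (g n) +
        complexBetti.map (CartesianMonoidalCategory.snd (projectiveSpace n ℂ) (projectiveSpace m ℂ)) 2 (g m))
    {E₀ : AbelianVariety ℂ} {ψ₀ : E₀ ⟶ E₀} {d : ℕ} (hE : E₀.dim = 1) (hd : 0 < d) (hψ : ψ₀ ≫ ψ₀ = -(d • 𝟙 E₀))
    {n : ℕ} (hn : 1 ≤ n) :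
    ∃ (A : AbelianVariety ℂ) (φ : A ⟶ A), IsWeilType A φ n d ∧
      (∀ u : complexBetti A.X 1, IsOfHodgeType A.dim A.X 1 1 0 u →
        u ∈ Submodule.span ℂ {y : complexBetti A.X 1 | ∃ (q : A ⟶ E₀) (w : complexBetti E₀.X 1),
          IsOfHodgeType E₀.dim E₀.X 1 1 0 w ∧ y = complexBetti.map q.hom.hom.hom 1 w}) ∧
      IsOfCMType A ∧
      ∀ δ : weilNormResidueGroup d, weilSign d δ = (-1) ^ n →
        ∃ e : ProjectiveEmbedding A.X, 1 ≤ e.n ∧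
          HasWeilDiscriminantNondeg A φ n d
              ((d : ℂ) • complexBetti.map e.ι 2 (g e.n) + complexBetti.map φ.hom.hom.hom 2 (complexBetti.map e.ι 2 (g e.n)))
              δ ∧
          lefschetzPow ((d : ℂ) • complexBetti.map e.ι 2 (g e.n) + complexBetti.map φ.hom.hom.hom 2 (complexBetti.map e.ι 2 (g e.n)))
              (2 * n - 1) 2
            ((d : ℂ) • complexBetti.map e.ι 2 (g e.n) + complexBetti.map φ.hom.hom.hom 2 (complexBetti.map e.ι 2 (g e.n))) ≠ 0 := by
  obtain ⟨hW₁, hall₁⟩ := cmSquare_isWeilType_and_forall_weights g hgr hgnz hgσ hE hd hψ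
  have hgen₁ : ∀ u : complexBetti (E₀.prod E₀).X 1, IsOfHodgeType (E₀.prod E₀).dim (E₀.prod E₀).X 1 1 0 u →
      u ∈ Submodule.span ℂ {y : complexBetti (E₀.prod E₀).X 1 | ∃ (q : E₀.prod E₀ ⟶ E₀) (w : complexBetti E₀.X 1),
        IsOfHodgeType E₀.dim E₀.X 1 1 0 w ∧ y = complexBetti.map q.hom.hom.hom 1 w} :=
    AbelianVariety.hodgeOneZero_mem_span_pullback_prod E₀ E₀ E₀
      (AbelianVariety.hodgeOneZero_mem_span_pullback_self E₀) (AbelianVariety.hodgeOneZero_mem_span_pullback_self E₀)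
  have hcm₁ : IsOfCMType (E₀.prod E₀) := (isOfCMType_of_cmCurve hE hd hψ).prod (isOfCMType_of_cmCurve hE hd hψ)
  induction n, hn using Nat.le_induction with
  | base =>
    refine ⟨E₀.prod E₀, _, hW₁, hgen₁, hcm₁, fun δ hδ => ?_⟩
    obtain ⟨q, rfl⟩ := QuotientGroup.mk_surjective δ
    rw [show ((-1 : ℤˣ) ^ (1 : ℕ)) = -1 from pow_one _, weilSign_mk, ratSign_eq_neg_one_iff] at hδ
    obtain ⟨a, b, ha, hb, hab⟩ := exists_mk_neg_natCast_mul_eq d q hδ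
    have h0 : ((a : ℚ) * b) ≠ 0 := by positivity
    rw [← hab h0]
    exact hall₁ ha hb h0
  | succ n hn IH =>
    obtain ⟨A, φ, hWA, hgA, hcA, hallA⟩ := IH
    have h11 : (((1 : ℕ) : ℚ) * (1 : ℕ)) ≠ 0 := by norm_num
    have hneg : ((-(Units.mk0 _ h11) : ℚˣ) : ℚ) < 0 := by simp
    refine ⟨A.prod (E₀.prod E₀), AbelianVariety.prodLift (AbelianVariety.fst A (E₀.prod E₀) ≫ φ)
      (AbelianVariety.snd A (E₀.prod E₀) ≫ AbelianVariety.prodLift (AbelianVariety.fst E₀ E₀ ≫ ψ₀)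
        (AbelianVariety.snd E₀ E₀ ≫ (-ψ₀))), isWeilType_prod hWA hW₁,
      AbelianVariety.hodgeOneZero_mem_span_pullback_prod E₀ A (E₀.prod E₀) hgA hgen₁, hcA.prod hcm₁, fun δ hδ => ?_⟩
    have hδ' : weilSign d (δ * QuotientGroup.mk (-(Units.mk0 _ h11))) = (-1) ^ n := by
      rw [map_mul, hδ, weilSign_mk_of_neg d hneg, show ((-1 : ℤˣ) ^ (n + 1 : ℕ)) = (-1) ^ (n : ℕ) * (-1) from pow_succ _ _,
        mul_assoc, show ((-1 : ℤˣ) * -1) = 1 from by simp, mul_one]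
    obtain ⟨eA, heA, hNA, htA⟩ := hallA _ hδ'
    obtain ⟨eB, heB, hNB, htB⟩ := hall₁ one_pos one_pos h11
    obtain ⟨e, hen, hecl⟩ := exists_projectiveEmbedding_prod g hgσ eA eB
    obtain ⟨hP, htP⟩ := hasWeilDiscriminantNondeg_prod hWA.pos hW₁.pos hWA.dim_eq hW₁.dim_eq
      (isRationalClass_ksymm d φ eA (hgr _)) (isRationalClass_ksymm d _ eB (hgr _)) htA htB hNA hNB
    have hK : (d : ℂ) • complexBetti.map e.ι 2 (g e.n) +
        complexBetti.map (AbelianVariety.prodLift (AbelianVariety.fst A (E₀.prod E₀) ≫ φ)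
          (AbelianVariety.snd A (E₀.prod E₀) ≫ AbelianVariety.prodLift (AbelianVariety.fst E₀ E₀ ≫ ψ₀)
            (AbelianVariety.snd E₀ E₀ ≫ (-ψ₀)))).hom.hom.hom 2 (complexBetti.map e.ι 2 (g e.n)) =
        complexBetti.map (AbelianVariety.fst A (E₀.prod E₀)).hom.hom.hom 2
            ((d : ℂ) • complexBetti.map eA.ι 2 (g eA.n) + complexBetti.map φ.hom.hom.hom 2 (complexBetti.map eA.ι 2 (g eA.n))) +
          complexBetti.map (AbelianVariety.snd A (E₀.prod E₀)).hom.hom.hom 2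
            ((d : ℂ) • complexBetti.map eB.ι 2 (g eB.n) +
              complexBetti.map (AbelianVariety.prodLift (AbelianVariety.fst E₀ E₀ ≫ ψ₀)
                (AbelianVariety.snd E₀ E₀ ≫ (-ψ₀))).hom.hom.hom 2 (complexBetti.map eB.ι 2 (g eB.n))) := by
      rw [hecl]; exact smul_add_map_prodLift φ _ (d : ℂ) _ _
    have hxx : (-(Units.mk0 _ h11) : ℚˣ) * -(Units.mk0 _ h11) = 1 := by ext; simp
    have hmul : δ * QuotientGroup.mk (-(Units.mk0 _ h11)) * QuotientGroup.mk (-(Units.mk0 _ h11)) = δ := by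
      rw [mul_assoc, ← QuotientGroup.mk_mul, hxx, QuotientGroup.mk_one, mul_one]
    refine ⟨e, le_trans heB hen, ?_, ?_⟩
    · rw [hK, ← hmul]; exact hP
    · rw [hK]; exact htP

/-! ### §3 The headline: one CM member on every right-sign component, on which HC holds -/

/-- **ONE CM ABELIAN VARIETY ON EVERY COMPONENT.** For `n ≥ 1`, `d ≥ 1` there is a pair `(A, φ)` — `A` an abelian
`2n`-fold, `φ ≫ φ = -d`, of Weil type `(n, d)`, of CM type, SATISFYING THE HODGE CONJECTURE (Tate: `A = (E₀ × E₀)ⁿ`,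
`E₀ = ℂ/ℤ[√-d]`) — such that for EVERY class `δ ∈ ℚˣ/Nm(K_dˣ)` with `sign δ = (-1)ⁿ` some `K`-symmetrised hyperplane
class `d·e^*a + φ^*e^*a` (`a ≠ 0` rational) of this same `(A, φ)` has non-degenerate discriminant class exactly `δ`:
the polarized triple `(A, φ, d·e^*a + φ^*e^*a)` is a member of the component `(n, d, δ)` — for all `δ` at once.
CM points distinguish no component. UNCONDITIONAL. [cite: vanGeemen1994HodgeAV, Thm. 4.3, 4.11, 4.14 and 5.3] -/
theorem exists_commonCMMember {n d : ℕ} (hn : 0 < n) (hd : 0 < d) :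
    ∃ (A : AbelianVariety ℂ) (φ : A ⟶ A), A.dim = 2 * n ∧ IsSmoothProjective (2 * n) A.X ∧ φ ≫ φ = -(d • 𝟙 A) ∧
      IsWeilType A φ n d ∧ IsOfCMType A ∧ HodgeConjectureFor A.dim A.X ∧
      ∀ δ : weilNormResidueGroup d, weilSign d δ = (-1) ^ n →
        ∃ (e : ProjectiveEmbedding A.X) (a : complexBetti (projectiveSpace e.n ℂ) 2), IsRationalClass a ∧ a ≠ 0 ∧
          HasWeilDiscriminantNondeg A φ n d
            ((d : ℂ) • complexBetti.map e.ι 2 a + complexBetti.map φ.hom.hom.hom 2 (complexBetti.map e.ι 2 a)) δ := by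
  obtain ⟨g, hgr, hgnz, hgσ⟩ := exists_segreHyperplaneClasses
  obtain ⟨E₀, ψ₀, hE, hψ⟩ := Literature.NumberTheory.EllipticCurves.CMEndomorphism.exists_cmCurve_sqrt_neg d hd
  obtain ⟨A, φ, hW, hgen, hcm, hall⟩ := exists_commonCMMember_aux g hgr hgnz hgσ hE hd hψ hn
  refine ⟨A, φ, hW.dim_eq, hW.isSmoothProjective, hW.sq_eq, hW, hcm,
    EllipticCurve.hodgeConjectureFor_of_hodgeOneZero_mem_span_pullback hE ψ₀ hd hψ A hgen, fun δ hδ => ?_⟩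
  obtain ⟨e, hen, hN, -⟩ := hall δ hδ
  exact ⟨e, g e.n, hgr _, hgnz _ hen, hN⟩

/-- **The classes realised on the common CM member are EXACTLY the inhabited components.** With gen 7's sign theorem
(`weilSign_eq_of_hasWeilDiscriminantNondeg`): for the pair `(A, φ)` of `exists_commonCMMember`, a class `δ` is the
discriminant class of some `K`-symmetrised hyperplane class on `(A, φ)` if and only if `sign δ = (-1)ⁿ`, i.e. iff the
component `(n, d, δ)` is inhabited at all (`Ring2.AbelianAll.weilClassesComponent_inhabited_iff_sign`).
[cite: vanGeemen1994HodgeAV, 4.11, 4.14 and Lemma 5.2 (4)] -/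
theorem commonCMMember_realises_iff_sign {n d : ℕ} (hn : 0 < n) (hd : 0 < d) :
    ∃ (A : AbelianVariety ℂ) (φ : A ⟶ A), IsWeilType A φ n d ∧ IsOfCMType A ∧ HodgeConjectureFor A.dim A.X ∧
      ∀ δ : weilNormResidueGroup d,
        (∃ (e : ProjectiveEmbedding A.X) (a : complexBetti (projectiveSpace e.n ℂ) 2), IsRationalClass a ∧ a ≠ 0 ∧
          HasWeilDiscriminantNondeg A φ n d
            ((d : ℂ) • complexBetti.map e.ι 2 a + complexBetti.map φ.hom.hom.hom 2 (complexBetti.map e.ι 2 a)) δ) ↔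
        weilSign d δ = (-1) ^ n := by
  obtain ⟨A, φ, -, -, -, hW, hcm, hHC, hall⟩ := exists_commonCMMember hn hd
  refine ⟨A, φ, hW, hcm, hHC, fun δ => ⟨?_, hall δ⟩⟩
  rintro ⟨e, a, ha, ha0, hN⟩
  exact weilSign_eq_of_hasWeilDiscriminantNondeg hW e ha ha0 hN

/-- **At the common CM member the conclusion of EVERY right-sign cell target holds.** One pair `(A, φ)` meets the
premises of `Hypotheses.WeilClassesComponent n d δ` for every `δ` with `sign δ = (-1)ⁿ` (with some embedding and
hyperplane class per `δ`), carries a non-zero rational `(n,n)` Weil class, and every rational `(n,n)` class on `A` —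
in particular every Weil class, for every `δ` — is algebraic (Tate). The census reading: the CM point is a point of
every component and decides none of them. UNCONDITIONAL. [cite: vanGeemen1994HodgeAV, Thm. 4.3, 4.14 and 5.3] -/
theorem weilClassesComponent_conclusion_at_commonCMMember {n d : ℕ} (hn : 0 < n) (hd : 0 < d) :
    ∃ (A : AbelianVariety ℂ) (φ : A ⟶ A), A.dim = 2 * n ∧ IsSmoothProjective (2 * n) A.X ∧ φ ≫ φ = -(d • 𝟙 A) ∧
      (∀ δ : weilNormResidueGroup d, weilSign d δ = (-1) ^ n →
        ∃ (e : ProjectiveEmbedding A.X) (a : complexBetti (projectiveSpace e.n ℂ) 2), IsRationalClass a ∧ a ≠ 0 ∧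
          HasWeilDiscriminantNondeg A φ n d
            ((d : ℂ) • complexBetti.map e.ι 2 a + complexBetti.map φ.hom.hom.hom 2 (complexBetti.map e.ι 2 a)) δ) ∧
      (∃ c ∈ weilClassesOf A φ n d, IsRationalClass c ∧ IsOfHodgeType (2 * n) A.X (2 * n) n n c ∧ c ≠ 0) ∧
      ∀ c : complexBetti A.X (2 * n), IsRationalClass c → IsOfHodgeType (2 * n) A.X (2 * n) n n c →
        c ∈ algebraicClasses A.X n := by
  obtain ⟨A, φ, hA, hX, hφ, hW, -, hHC, hall⟩ := exists_commonCMMember hn hd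
  refine ⟨A, φ, hA, hX, hφ, hall, exists_weilClass_of_isWeilType hW, fun c hc hcH => hHC.2 n c hc ?_⟩
  rw [hA]; exact hcH

end Summit.HodgeConjecture.HodgeConjecture.Ring2.WeilCoverage

end
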